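import Literature.NumberTheory.Automorphic.Zelevinsky1980.UnitaryCharacterInductionIrreducible  -- ★ `parabolicIndGL_detChar_unitary_isIrreducible_holds` (Zelevinsky Thm. 4.2)
import Literature.NumberTheory.Automorphic.Zelevinsky1980.DetCharInducingDatum               -- ★ `detCharDatum_isSmooth`
import Literature.NumberTheory.Automorphic.Zelevinsky1980.JacquetOfInducedMaximalParabolic     -- ★ congruence boxes in `N′`, membership criterion
import Literature.NumberTheory.Automorphic.SmoothInductionParabolicNontrivial                 -- ★ `toFun_cellSection_w₀`, `cellSection_ne_zero`
import Literature.NumberTheory.Automorphic.IrreducibleClassesConstituents                     -- ★ `IsConstituentOf.nonempty_equiv_of_isIrreducible`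
import Literature.NumberTheory.Automorphic.IrreducibleClassesComap                            -- ★ `IrrClass.comap_mk`, `SmoothIrrep.comap_V`
import Literature.NumberTheory.Automorphic.SmoothCharacterOfCharacter                         -- ★ `SmoothIrrep.ofChar` (the one-dimensional classes)
import HarnessLib

/-!
# R90-TF · S5 «Ch. 13.3» — (T′)-LOCAL, SPLIT HALF: a ONE-DIMENSIONAL class is never a constituent of the unitary
# principal series `i_{GL₂}(ν₁, ν₃)` (`Theorems/R90S5OneDimNotThetaMemberLocal.lean`)

Cell `hodgecm-mathlib`, crux H413 (`stmt-HodgeConjecture-24833`), route of record `HCCMUnconditional`; programme R90-TF,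
section S5 (dealer `R90-C133-plan (g0)`, DEAL #17 2026-09-04T16:24:32Z → seat R90-C14-p03 (g0); census
`R90/S5/R90-C14-p03/CENSUS-OneDimNotTheta.md` 7142dd1bc78e211a).  Helper lane `--supports stmt-HodgeConjecture-24833 --as helper`;
THEOREMS ONLY (no definition, no instance, no notation, no named-fact hypothesis, no `sorry`).

THE PRINT [Rogawski1990, §11.1 Prop. 11.1.1 (a) p. 161–162: «a discrete L-packet of `U(2)` has more than one element iff
it is `ρ(θ)`, θ regular»; §11.4 Prop. 11.4.1 (a) p. 166: «If `ρ = ρ(θ)`, then `ρ̃ = i_{G̃}(μ(θ))`», `μ(θ) = (θ̃₁μ⁻¹, θ̃₃μ⁻¹)`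
UNITARY; hence at a place `v` of `L⁺` SPLIT in `L` the member of `ρ(θ)_v` is the unitary principal series
`i_{GL₂(L_w)}(ν₁, ν₃)` — IRREDUCIBLE and infinite-dimensional [Zelevinsky1980, Thm. 4.2; §3.2 Example p. 181], so it is never
a character `η ∘ det`].  This is the SPLIT clause of S5's ★-pending `R90.S5.IsThetaMemberAt` (`Theorems/R90S5ThetaOfRecordDefs.lean`
:72–:110, seat R90-C133-p03): «`(IrrClass.comap (localSplitEquiv …).symm c).IsConstituentOf (Representation.parabolicIndGL (L_w)
(lastBlockLabel 2) ((Representation.trivial ℂ _ ℂ).twist (maxParabolicLeviChar _ 2 ν₁ ν₃)))`» — the law (T′) «a one-dimensional `ξ`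
is never `IsThetaOfRecord`» pays its split half by `simp only [IsThetaMemberAt]` + the theorems below.

WHAT IS PROVED (hypothesis-first, over ANY non-archimedean local field `F`; «one-dimensional» = ANY `r : SmoothIrrep _` with
`Module.finrank ℂ r.V = 1`, which covers ★ `SmoothIrrep.ofChar η hη` (`.V = ℂ`, `rfl`)):
* `not_isConstituentOf_parabolicIndGL_two_of_finrank_eq_one` — for UNITARY CONTINUOUS `ν₁, ν₃ : Fˣ → ℂˣ` (no `ν₁ ≠ ν₃`
  needed) and `r` one-dimensional, `⟦r⟧` is NOT a constituent of `i_{GL₂(F)}(ν₁, ν₃)` =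
  `Representation.parabolicIndGL F (lastBlockLabel 2) (𝟙.twist (maxParabolicLeviChar F 2 ν₁ ν₃))`;
* `not_isConstituentOf_parabolicIndGL_two_comap_of_finrank_eq_one` — the same for `IrrClass.comap e ⟦r⟧` along any
  `e : GL (Fin 2) F ≃ₜ* G′` (the clause's `IrrClass.comap (localSplitEquiv …).symm c` shape; `(r.comap e).V = r.V` is `rfl`);
* `not_isConstituentOf_parabolicIndGL_two_comap_ofChar` — the same for the class `⟦ℂ_η⟧` of a smooth character `η` of `G′`.
PROOF.  ★ `Zelevinsky1980.parabolicIndGL_detChar_unitary_isIrreducible_holds` (the named fact of `ParabolicIndGLDetCharIrreducible`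
is DISCHARGED in the tree): `i(ν₁, ν₃)` is irreducible; a constituent of an irreducible representation is EQUIVALENT to it
(★ `IsConstituentOf.nonempty_equiv_of_isIrreducible`), so `i(ν₁, ν₃)` would be a line; but it contains two standard sections
`Φ_{K₁,1}`, `Φ_{K₂,1}` of the open cell (★ `cellSection`) for the congruence boxes `K₂ = N′ ∩ K_{ϖ²} < K₁ = N′ ∩ K_ϖ` of
`N′ ≅ F`, and at the point `w₀ · n(ϖ)` the first takes the value `1` and the second `0` (★ `cellSectionFun_eq_of_mem` ∕
`cellSectionFun_eq_zero_of_not_mem`), while `Φ_{K₂,1}(w₀) = 1 ≠ 0` (★ `toFun_cellSection_w₀`) — so `Φ_{K₁,1}` is not a multiple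
of `Φ_{K₂,1}` and the space is not a line (Mathlib `finrank_eq_one_iff_of_nonzero'`).
HONEST LABEL: a LOCAL lemma; it proves no printed global statement; the NON-SPLIT half of (T′)-local is NOT here (census: GAP modulo
exactness of the Jacquet functor on subquotients of `i(χ)` for `U(Φ₂)`).  HC_CM is proved only modulo the 7 printed citations
(2 remaining named inputs: hLiu418 = stmt-HodgeConjecture-24832, h413 = stmt-HodgeConjecture-24833) until rung 0 closes.

## References
* [Rogawski1990] J. D. Rogawski, *Automorphic Representations of Unitary Groups in Three Variables*, Ann. of Math. Stud. 123 (1990),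
  §11.1 Prop. 11.1.1 (a) pp. 161–162; §11.4 Prop. 11.4.1 (a) p. 166; §12.1 pp. 170–171; §4.13 p. 62.
* [Zelevinsky1980] A. V. Zelevinsky, *Induced representations of reductive 𝔭-adic groups II*, Ann. Sci. ÉNS 13 (1980), §3.2 Example
  p. 181, Thm. 4.2 p. 184.
* [BernsteinZelevinskyRMS1976] I. N. Bernstein, A. V. Zelevinsky, Russian Math. Surveys 31:3 (1976), §2.22–2.24 (standard sections).
-/

set_option autoImplicit false
-- the mandated namespace repeats the single-problem summit's segment (`HodgeConjecture.HodgeConjecture`)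
set_option linter.dupNamespace false

noncomputable section

open Literature.NumberTheory.Automorphic Literature.NumberTheory.Automorphic.Zelevinsky1980
open ValuativeRel

namespace Summit.HodgeConjecture.HodgeConjecture.R90.S5

universe u

section Core

variable (F : Type u) [Field F] [ValuativeRel F] [TopologicalSpace F] [IsNonarchimedeanLocalField F]

/-- **The unitary principal series of `GL₂(F)` is not a line.**  For continuous `ν₁, ν₃`, the carrier
`Ind_{Q_{1,1}}^{GL₂} σ′` of `i(ν₁, ν₃)` (inducing datum `σ′ = ((ν₁∘det) ⊠ ν₃) ∘ proj ⊗ δ^{1/2}`) does not have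
`Module.finrank = 1`: the standard sections `Φ_{K₁,1}`, `Φ_{K₂,1}` of the congruence boxes `K₂ = N′ ∩ K_{ϖ²} < K₁ = N′ ∩ K_ϖ`
are not proportional (values `1 ∕ 0` at `w₀ n(ϖ)`, and `Φ_{K₂,1}(w₀) = 1`). [cite: BernsteinZelevinskyRMS1976, §2.22–2.24]
[cite: Zelevinsky1980, §3.2 Example, p. 181] -/
theorem finrank_parabolicIndGL_two_ne_one [LocallyCompactSpace (standardParabolicGL F (lastBlockLabel 2))]
    (ν₁ ν₃ : Fˣ →* ℂˣ) (hν₁c : Continuous fun x => ((ν₁ x : ℂˣ) : ℂ)) (hν₃c : Continuous fun x => ((ν₃ x : ℂˣ) : ℂ)) :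
    Module.finrank ℂ (Representation.SmoothInd (standardParabolicGL F (lastBlockLabel 2))
      (Representation.twist
        (((Representation.trivial ℂ (Π a : Bool, GL {i : Fin 2 // lastBlockLabel 2 i = a} F) ℂ).twist
          (maxParabolicLeviChar F 2 ν₁ ν₃)).comp (leviProjection F (lastBlockLabel 2)))
        (rootDeltaChar (standardParabolicGL F (lastBlockLabel 2))))) ≠ 1 := by
  classical
  -- the inducing datum and its smoothness
  set σ' := Representation.twist
        (((Representation.trivial ℂ (Π a : Bool, GL {i : Fin 2 // lastBlockLabel 2 i = a} F) ℂ).twist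
          (maxParabolicLeviChar F 2 ν₁ ν₃)).comp (leviProjection F (lastBlockLabel 2)))
        (rootDeltaChar (standardParabolicGL F (lastBlockLabel 2))) with hσ'def
  have hσ' : σ'.IsSmooth := detCharDatum_isSmooth F 2 ν₁ ν₃ hν₁c hν₃c
  have hc : Monotone (lastBlockLabel 2) := monotone_lastBlockLabel 2
  -- a uniformizer and the two congruence boxes `K₂ = N′ ∩ K_{ϖ²} ≤ K₁ = N′ ∩ K_ϖ` of `N′`
  obtain ⟨ϖ, hϖ⟩ := exists_isUniformizingElement (F := F)
  have hvϖ0 : valuation F ϖ ≠ 0 := (Valuation.ne_zero_iff _).mpr hϖ.ne_zero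
  have hvϖ1 : valuation F ϖ < 1 := hϖ.valuation_lt_one
  have hvϖ2 : valuation F ϖ * valuation F ϖ < valuation F ϖ := by
    simpa only [one_mul] using mul_lt_mul_of_pos_right hvϖ1 (zero_lt_iff.mpr hvϖ0)
  set K₁ : Subgroup ↥(oppositeCellRadical (K := F) (lastBlockLabel 2)) :=
    (congruenceGL 2 (valuation F ϖ)).comap (oppositeCellRadical (K := F) (lastBlockLabel 2)).subtype with hK₁def
  set K₂ : Subgroup ↥(oppositeCellRadical (K := F) (lastBlockLabel 2)) :=
    (congruenceGL 2 (valuation F ϖ * valuation F ϖ)).comap (oppositeCellRadical (K := F) (lastBlockLabel 2)).subtype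
    with hK₂def
  have hK₁o : IsOpen (K₁ : Set ↥(oppositeCellRadical (K := F) (lastBlockLabel 2))) := isOpen_comap_congruenceGL hvϖ0
  have hK₁c : IsCompact (K₁ : Set ↥(oppositeCellRadical (K := F) (lastBlockLabel 2))) := isCompact_comap_congruenceGL _
  have hK₂o : IsOpen (K₂ : Set ↥(oppositeCellRadical (K := F) (lastBlockLabel 2))) :=
    isOpen_comap_congruenceGL (mul_ne_zero hvϖ0 hvϖ0)
  have hK₂c : IsCompact (K₂ : Set ↥(oppositeCellRadical (K := F) (lastBlockLabel 2))) := isCompact_comap_congruenceGL _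
  have memK : ∀ {γ : ValueGroupWithZero F} (hγ : γ < 1) (x : ↥(oppositeCellRadical (K := F) (lastBlockLabel 2))),
      x ∈ ((congruenceGL 2 γ).comap (oppositeCellRadical (K := F) (lastBlockLabel 2)).subtype :
          Subgroup ↥(oppositeCellRadical (K := F) (lastBlockLabel 2))) ↔
        valuation F (((x : GL (Fin 2) F) : Matrix (Fin 2) (Fin 2) F) 0 1) ≤ γ := by
    intro γ hγ x
    rw [Subgroup.mem_comap, Subgroup.coe_subtype, mem_congruenceGL_iff_of_mem_oppositeCellRadical (n := 0) hγ x.2]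
    constructor
    · intro h
      exact h 1 one_ne_zero
    · intro h j hj
      have hj1 : j = 1 := by
        fin_cases j
        · exact absurd rfl hj
        · rfl
      rw [hj1]
      exact h
  -- the point `n(ϖ) ∈ K₁ ∖ K₂` of `N′`
  obtain ⟨e, heN, -, hemat⟩ := exists_transvection_mem (F := F) (n := 0) ϖ
  have he01 : ((e : GL (Fin 2) F) : Matrix (Fin 2) (Fin 2) F) 0 1 = ϖ := by
    rw [hemat]
    simp [Matrix.transvection]
  have heK₁ : (⟨e, heN⟩ : ↥(oppositeCellRadical (K := F) (lastBlockLabel 2))) ∈ (K₁ : Set _) := by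
    rw [SetLike.mem_coe, hK₁def, memK hvϖ1, he01]
  have heK₂ : (⟨e, heN⟩ : ↥(oppositeCellRadical (K := F) (lastBlockLabel 2))) ∉ (K₂ : Set _) := by
    rw [SetLike.mem_coe, hK₂def, memK (hvϖ2.trans hvϖ1), he01]
    exact not_le.mpr hvϖ2
  -- the two standard sections
  set Φ₁ := cellSection σ' hc hσ' K₁ hK₁o hK₁c (1 : ℂ) with hΦ₁def
  set Φ₂ := cellSection σ' hc hσ' K₂ hK₂o hK₂c (1 : ℂ) with hΦ₂def
  have hP1 : (1 : GL (Fin 2) F) ∈ standardParabolicGL F (lastBlockLabel 2) := Subgroup.one_mem _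
  have hone : (⟨(1 : GL (Fin 2) F), hP1⟩ : ↥(standardParabolicGL F (lastBlockLabel 2))) = 1 := Subtype.ext rfl
  have hΦ₁e : Φ₁.toFun (1 * permGL Fin.revPerm * e) = 1 := by
    rw [hΦ₁def, toFun_cellSection, cellSectionFun_eq_of_mem hc (1 : ℂ) hP1 heN heK₁, hone, map_one σ']
    rfl
  have hΦ₂e : Φ₂.toFun (1 * permGL Fin.revPerm * e) = 0 := by
    rw [hΦ₂def, toFun_cellSection, cellSectionFun_eq_zero_of_not_mem hc (1 : ℂ) hP1 heN heK₂]
  have hΦ₂ne : Φ₂ ≠ 0 := cellSection_ne_zero σ' hc hσ' K₂ hK₂o hK₂c one_ne_zero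
  -- a line through `Φ₂` would contain `Φ₁`: impossible at the point `w₀ n(ϖ)`
  intro h1
  obtain ⟨a, ha⟩ := (finrank_eq_one_iff_of_nonzero' Φ₂ hΦ₂ne).mp h1 Φ₁
  have hval := congrArg (fun Φ : Representation.SmoothInd (standardParabolicGL F (lastBlockLabel 2)) σ' =>
    Φ.toFun (1 * permGL Fin.revPerm * e)) ha
  simp only [Representation.SmoothInd.toFun_smul, Pi.smul_apply, hΦ₂e, smul_zero, hΦ₁e] at hval
  exact zero_ne_one hval

/-- **(T′)-local, SPLIT half** [Rogawski1990, Prop. 11.1.1 (a) p. 161; Prop. 11.4.1 (a) p. 166; Zelevinsky1980 Thm. 4.2]: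
for a non-archimedean local field `F` and UNITARY CONTINUOUS characters `ν₁, ν₃ : Fˣ → ℂˣ` (no regularity `ν₁ ≠ ν₃` needed),
NO one-dimensional class `⟦r⟧` (`Module.finrank ℂ r.V = 1`; e.g. `r = SmoothIrrep.ofChar (η ∘ det) _`) is a constituent of the
unitary principal series `i_{GL₂(F)}(ν₁, ν₃) = Representation.parabolicIndGL F (lastBlockLabel 2) (𝟙.twist (maxParabolicLeviChar F 2 ν₁ ν₃))`
— it is irreducible (★ `Zelevinsky1980.parabolicIndGL_detChar_unitary_isIrreducible_holds`) and not a line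
(`finrank_parabolicIndGL_two_ne_one`).  The split clause of ★-pending `R90.S5.IsThetaMemberAt` for a one-dimensional class.
[cite: Rogawski1990, §11.1 Prop. 11.1.1 (a) p. 161] [cite: Rogawski1990, §11.4 Prop. 11.4.1 (a) p. 166]
[cite: Zelevinsky1980, Thm. 4.2 (2)⇒(1), p. 184 (with §3.2 Example, p. 181)] -/
theorem not_isConstituentOf_parabolicIndGL_two_of_finrank_eq_one
    [LocallyCompactSpace (standardParabolicGL F (lastBlockLabel 2))]
    (ν₁ ν₃ : Fˣ →* ℂˣ) (hν₁u : ∀ x, ‖((ν₁ x : ℂˣ) : ℂ)‖ = 1) (hν₁c : Continuous fun x => ((ν₁ x : ℂˣ) : ℂ))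
    (hν₃u : ∀ x, ‖((ν₃ x : ℂˣ) : ℂ)‖ = 1) (hν₃c : Continuous fun x => ((ν₃ x : ℂˣ) : ℂ))
    (r : SmoothIrrep (GL (Fin 2) F)) (hr : Module.finrank ℂ r.V = 1) :
    ¬ (IrrClass.mk r).IsConstituentOf
      (Representation.parabolicIndGL F (lastBlockLabel 2)
        ((Representation.trivial ℂ (Π a : Bool, GL {i : Fin 2 // lastBlockLabel 2 i = a} F) ℂ).twist
          (maxParabolicLeviChar F 2 ν₁ ν₃))) := by
  intro h
  haveI := parabolicIndGL_detChar_unitary_isIrreducible_holds F 2 ν₁ ν₃ hν₁u hν₁c hν₃u hν₃c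
  obtain ⟨e⟩ := h.nonempty_equiv_of_isIrreducible
  have h1 := e.toLinearEquiv.finrank_eq
  rw [hr] at h1
  exact finrank_parabolicIndGL_two_ne_one F ν₁ ν₃ hν₁c hν₃c h1.symm

end Core

section Transport

variable {F : Type u} [Field F] [ValuativeRel F] [TopologicalSpace F] [IsNonarchimedeanLocalField F]
  {G' : Type u} [Group G'] [TopologicalSpace G']

/-- **(T′)-local, SPLIT half, read on another model `G′ ≃ GL₂(F)`** (the shape of the split clause of `R90.S5.IsThetaMemberAt`,
which reads a class `c` of `U(Φ₂)(L⁺_v)` on `GL₂(L_w)` as `IrrClass.comap (localSplitEquiv …).symm c`): for any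
`e : GL (Fin 2) F ≃ₜ* G′` and any one-dimensional `r : SmoothIrrep G′`, `IrrClass.comap e ⟦r⟧` is not a constituent of
`i_{GL₂(F)}(ν₁, ν₃)` (`(r.comap e).V = r.V` definitionally). [cite: Rogawski1990, §11.4 Prop. 11.4.1 (a) p. 166; §4.13 p. 62]
[cite: Zelevinsky1980, Thm. 4.2 (2)⇒(1), p. 184] -/
theorem not_isConstituentOf_parabolicIndGL_two_comap_of_finrank_eq_one
    [LocallyCompactSpace (standardParabolicGL F (lastBlockLabel 2))]
    (ν₁ ν₃ : Fˣ →* ℂˣ) (hν₁u : ∀ x, ‖((ν₁ x : ℂˣ) : ℂ)‖ = 1) (hν₁c : Continuous fun x => ((ν₁ x : ℂˣ) : ℂ))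
    (hν₃u : ∀ x, ‖((ν₃ x : ℂˣ) : ℂ)‖ = 1) (hν₃c : Continuous fun x => ((ν₃ x : ℂˣ) : ℂ))
    (e : GL (Fin 2) F ≃ₜ* G') (r : SmoothIrrep G') (hr : Module.finrank ℂ r.V = 1) :
    ¬ (IrrClass.comap e (IrrClass.mk r)).IsConstituentOf
      (Representation.parabolicIndGL F (lastBlockLabel 2)
        ((Representation.trivial ℂ (Π a : Bool, GL {i : Fin 2 // lastBlockLabel 2 i = a} F) ℂ).twist
          (maxParabolicLeviChar F 2 ν₁ ν₃))) := by
  rw [IrrClass.comap_mk]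
  exact not_isConstituentOf_parabolicIndGL_two_of_finrank_eq_one F ν₁ ν₃ hν₁u hν₁c hν₃u hν₃c (r.comap e) hr

/-- **(T′)-local, SPLIT half, for the class of a smooth character** `η : G′ → ℂˣ` (open kernel; e.g. `η = η₀ ∘ det` on
`U(Φ₂)(L⁺_v)`, the local component of a one-dimensional automorphic `ξ`): `IrrClass.comap e ⟦ℂ_η⟧` (★ `SmoothIrrep.ofChar`)
is not a constituent of `i_{GL₂(F)}(ν₁, ν₃)` for unitary continuous `ν₁, ν₃`.
[cite: Rogawski1990, §11.1 Prop. 11.1.1 (a) p. 161; §11.4 Prop. 11.4.1 (a) p. 166] [cite: Zelevinsky1980, Thm. 4.2 (2)⇒(1), p. 184] -/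
theorem not_isConstituentOf_parabolicIndGL_two_comap_ofChar [IsTopologicalGroup G']
    [LocallyCompactSpace (standardParabolicGL F (lastBlockLabel 2))]
    (ν₁ ν₃ : Fˣ →* ℂˣ) (hν₁u : ∀ x, ‖((ν₁ x : ℂˣ) : ℂ)‖ = 1) (hν₁c : Continuous fun x => ((ν₁ x : ℂˣ) : ℂ))
    (hν₃u : ∀ x, ‖((ν₃ x : ℂˣ) : ℂ)‖ = 1) (hν₃c : Continuous fun x => ((ν₃ x : ℂˣ) : ℂ))
    (e : GL (Fin 2) F ≃ₜ* G') (η : G' →* ℂˣ) (hη : IsOpen ((η.ker : Subgroup G') : Set G')) :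
    ¬ (IrrClass.comap e (IrrClass.mk (SmoothIrrep.ofChar η hη))).IsConstituentOf
      (Representation.parabolicIndGL F (lastBlockLabel 2)
        ((Representation.trivial ℂ (Π a : Bool, GL {i : Fin 2 // lastBlockLabel 2 i = a} F) ℂ).twist
          (maxParabolicLeviChar F 2 ν₁ ν₃))) :=
  not_isConstituentOf_parabolicIndGL_two_comap_of_finrank_eq_one ν₁ ν₃ hν₁u hν₁c hν₃u hν₃c e
    (SmoothIrrep.ofChar η hη) (Module.finrank_self ℂ)

end Transport

end Summit.HodgeConjecture.HodgeConjecture.R90.S5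

end
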